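import Literature.Barriers.CriticalPhenomena.KozmaNachmiasTwoPointSums
import Mathlib.Algebra.Order.Field.GeomSum
import HarnessLib

/-!
# Kozma–Nachmias 2011, Chapter 5: the dyadic tail estimates ("negligible when `K` is large")

Barrier catalogue `Literature/Barriers/CriticalPhenomena/` (D-0021), programme for the named fact
`KozmaNachmias2011_thm2`. The proofs of Lemmas 5.3 and 5.5 of Kozma–Nachmias 2011 end with dyadic
sums that are small for `K` large (p. 401: "`Σ_{t ≥ log(K/2)} t⁷ 2^{t(6-d)} ≤ C K^{6-d} log⁷ K` … when
`K` is chosen large enough"; p. 403: "`C K^{4-d} log⁷ K Σ_{t ≤ t₀} 2^{2t} + C Σ_{t > t₀} 2^{t(6-d)} t⁷ ≤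
C K^{6-d} log⁷ K`", with the terms `C 2^{td} e^{-t²}` "negligible"). This file PROVES these
estimates in the quantified form used downstream (`d ≥ 7`), for the dyadic shell weight
`shellWt d t = (2^{t-1})^{-(d-2)}` of `KozmaNachmiasTwoPointSums.lean` and the cluster-size budget

`psiKN d s = s⁴ log⁷ s + (2s+1)^d e^{-log² s}`

(the typical bound `|C(x) ∩ (x+Q_s)| < s⁴ log⁷ s` of (4.1) plus the trivial bound `|Q_s|` weighted by
the probability `e^{-log² s}` of a non-typical cluster at a regular vertex, Definition 4.1):

* `log_pow_seven_le_sqrt` (`log⁷ s ≤ 14⁷ √s`), `psiKN_le` (`ψ(s) ≤ 14⁷ s⁴ √s + 3^d` for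
  `s ≥ e^{d+5}`), `shellWt_mul_psiKN_le` (`shellWt t · ψ(2^{t+1}) ≤ A θ^t`, `θ = √2/2`);
* **`tail_large`** — for every `δ > 0`, for `K` large, `Σ_{t ∈ S} shellWt t · ψ(2^{t+1}) ≤ δ` over any
  finite set `S` of scales with `2^t ≥ K` (the sums over `t > t₀` of pp. 401, 403);
* **`tail_mid`** — for `K` large, `(Σ_{t ∈ S} shellWt t) · (2K)⁴ log⁷(2K) ≤ δ` over scales with
  `4 · 2^t ≥ K` (the finitely many scales `K/4 ≤ 2^t < K` of Lemma 5.3);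
* **`tail_small`** — for `K` large, `(Σ_{t ∈ S} shellWt t (2·2^t+1)^d) ψ(2K) / (K/4)^d ≤ δ` over scales
  with `2^t < K` (the sum over `t ≤ t₀` of p. 403 after the randomisation of `x'`, Claim 5.4, with
  `|A| ≥ (K/4)^d`).

## References

* G. Kozma, A. Nachmias, *Arm exponents in high dimensional percolation*, J. Amer. Math. Soc. 24
  (2011) 375–409: proof of Lemma 5.3 (p. 401), proof of Lemma 5.5 ((5.11)–(5.12) and the final
  display, p. 403).
-/

noncomputable section

namespace Literature.Barriers.CriticalPhenomena

open Finset Real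

variable {d : ℕ}

/-! ### The budget `ψ(s) = s⁴ log⁷ s + (2s+1)^d e^{-log² s}` -/

section Psi

/-- **`ψ(s) = s⁴ log⁷ s + (2s+1)^d e^{-log² s}`**: the bound on `E[|C(x) ∩ (x+Q_s)| ; E₁]/P(E₁)` at a
`K`-regular `x` (`s ≥ K`): `s⁴ log⁷ s` on the typical event (4.1) and `|Q_s| e^{-log² s}` off it
(Definition 4.1). [cite: KozmaNachmias2011, (4.1) and proof of Lemma 5.5 ((5.11), p. 403)] -/
def psiKN (d : ℕ) (s : ℝ) : ℝ := s ^ 4 * Real.log s ^ 7 + (2 * s + 1) ^ d * Real.exp (-(Real.log s ^ 2))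

/-- `ψ(s) ≥ 0` for `s ≥ 1`. [folklore] -/
theorem psiKN_nonneg {s : ℝ} (hs : 1 ≤ s) : 0 ≤ psiKN d s := by
  unfold psiKN
  have := Real.log_nonneg hs
  positivity

/-- `s⁴ log⁷ s ≤ ψ(s)` for `s ≥ 0`. [folklore] -/
theorem pow_mul_log_le_psiKN {s : ℝ} (hs : 0 ≤ s) : s ^ 4 * Real.log s ^ 7 ≤ psiKN d s := by
  unfold psiKN
  have : 0 ≤ (2 * s + 1) ^ d * Real.exp (-(Real.log s ^ 2)) := by positivity
  linarith

/-- **`log⁷ s ≤ 14⁷ √s`** for `s ≥ 1` (from `log s ≤ s^ε/ε` with `ε = 1/14`). [folklore] -/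
theorem log_pow_seven_le_sqrt {s : ℝ} (hs : 1 ≤ s) : Real.log s ^ 7 ≤ 14 ^ 7 * Real.sqrt s := by
  have hs0 : 0 ≤ s := by linarith
  have h1 : Real.log s ≤ s ^ (1 / 14 : ℝ) / (1 / 14) := Real.log_le_rpow_div hs0 (by norm_num)
  have h2 : Real.log s ≤ 14 * s ^ (1 / 14 : ℝ) := by rw [div_div_eq_mul_div, div_one, mul_comm] at h1; linarith [h1]
  have h3 : Real.log s ^ 7 ≤ (14 * s ^ (1 / 14 : ℝ)) ^ 7 :=
    pow_le_pow_left₀ (Real.log_nonneg hs) h2 7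
  calc Real.log s ^ 7 ≤ (14 * s ^ (1 / 14 : ℝ)) ^ 7 := h3
    _ = 14 ^ 7 * (s ^ (1 / 14 : ℝ)) ^ 7 := mul_pow _ _ _
    _ = 14 ^ 7 * Real.sqrt s := by
        congr 1
        rw [← Real.rpow_natCast, ← Real.rpow_mul hs0, Real.sqrt_eq_rpow]
        norm_num

/-- **`(2s+1)^d e^{-log² s} ≤ 3^d`** for `s ≥ e^{d+5}` (then `e^{-log² s} ≤ s^{-(d+5)}`).
[cite: KozmaNachmias2011, proof of Lemma 5.5 (p. 403: "This is negligible")] -/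
theorem pow_mul_exp_neg_log_sq_le {s : ℝ} (hs : Real.exp (d + 5) ≤ s) :
    (2 * s + 1) ^ d * Real.exp (-(Real.log s ^ 2)) ≤ 3 ^ d := by
  have hs1 : 1 ≤ s := le_trans (by have := Real.add_one_le_exp ((d : ℝ) + 5); linarith [this]) hs
  have hs0 : 0 < s := by linarith
  have hlog : (d : ℝ) + 5 ≤ Real.log s := by
    rw [Real.le_log_iff_exp_le hs0]; exact hs
  -- `e^{-log² s} ≤ e^{-(d+5) log s} = s^{-(d+5)}`
  have h1 : Real.exp (-(Real.log s ^ 2)) ≤ (s ^ (d + 5))⁻¹ := by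
    have : -(Real.log s ^ 2) ≤ -(((d + 5 : ℕ) : ℝ) * Real.log s) := by
      push_cast
      nlinarith [hlog, Real.log_nonneg hs1]
    calc Real.exp (-(Real.log s ^ 2)) ≤ Real.exp (-(((d + 5 : ℕ) : ℝ) * Real.log s)) := Real.exp_le_exp.2 this
      _ = (s ^ (d + 5))⁻¹ := by rw [Real.exp_neg, Real.exp_nat_mul, Real.exp_log hs0]
  calc (2 * s + 1) ^ d * Real.exp (-(Real.log s ^ 2)) ≤ (3 * s) ^ d * (s ^ (d + 5))⁻¹ :=
        mul_le_mul (pow_le_pow_left₀ (by positivity) (by linarith) d) h1 (by positivity) (by positivity)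
    _ = 3 ^ d * (s ^ d * (s ^ (d + 5))⁻¹) := by rw [mul_pow, mul_assoc]
    _ ≤ 3 ^ d * 1 := by
        refine mul_le_mul_of_nonneg_left ?_ (by positivity)
        rw [pow_add, mul_inv, ← mul_assoc, mul_inv_cancel₀ (pow_ne_zero _ hs0.ne'), one_mul]
        exact inv_le_one_of_one_le₀ (one_le_pow₀ hs1)
    _ = 3 ^ d := mul_one _

/-- **`ψ(s) ≤ 14⁷ s⁴ √s + 3^d`** for `s ≥ e^{d+5}`. [cite: KozmaNachmias2011, proof of Lemma 5.5 (p. 403)] -/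
theorem psiKN_le {s : ℝ} (hs : Real.exp (d + 5) ≤ s) :
    psiKN d s ≤ 14 ^ 7 * (s ^ 4 * Real.sqrt s) + 3 ^ d := by
  have hs1 : 1 ≤ s := le_trans (by have := Real.add_one_le_exp ((d : ℝ) + 5); linarith [this]) hs
  unfold psiKN
  have h1 : s ^ 4 * Real.log s ^ 7 ≤ 14 ^ 7 * (s ^ 4 * Real.sqrt s) := by
    calc s ^ 4 * Real.log s ^ 7 ≤ s ^ 4 * (14 ^ 7 * Real.sqrt s) :=
          mul_le_mul_of_nonneg_left (log_pow_seven_le_sqrt hs1) (by positivity)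
      _ = _ := by ring
  linarith [pow_mul_exp_neg_log_sq_le hs]

/-- **The crude bound `ψ(s) ≤ 14⁷ s⁴ √s + (2s+1)^d`** for `s ≥ 1`. [folklore] -/
theorem psiKN_le_crude {s : ℝ} (hs : 1 ≤ s) :
    psiKN d s ≤ 14 ^ 7 * (s ^ 4 * Real.sqrt s) + (2 * s + 1) ^ d := by
  unfold psiKN
  have h1 : s ^ 4 * Real.log s ^ 7 ≤ 14 ^ 7 * (s ^ 4 * Real.sqrt s) := by
    calc s ^ 4 * Real.log s ^ 7 ≤ s ^ 4 * (14 ^ 7 * Real.sqrt s) :=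
          mul_le_mul_of_nonneg_left (log_pow_seven_le_sqrt hs) (by positivity)
      _ = _ := by ring
  have h2 : (2 * s + 1) ^ d * Real.exp (-(Real.log s ^ 2)) ≤ (2 * s + 1) ^ d * 1 :=
    mul_le_mul_of_nonneg_left (Real.exp_le_one_iff.2 (neg_nonpos.2 (sq_nonneg _))) (by positivity)
  linarith

end Psi

/-! ### One dyadic term: `shellWt t · ψ(2^{t+1}) ≤ A θ^t` with `θ = √2/2` -/

section OneTerm

/-- `√(2^{n}) = (√2)^{n}`. [folklore] -/
theorem sqrt_two_pow (n : ℕ) : Real.sqrt ((2 : ℝ) ^ n) = Real.sqrt 2 ^ n := by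
  rw [show ((2 : ℝ) ^ n) = (Real.sqrt 2 ^ n) ^ 2 by
    rw [← pow_mul, mul_comm, pow_mul, Real.sq_sqrt (by norm_num : (0 : ℝ) ≤ 2)]]
  exact Real.sqrt_sq (by positivity)

/-- `√2 < 2`. [folklore] -/
theorem sqrt_two_lt_two : Real.sqrt 2 < 2 := by
  rw [Real.sqrt_lt' (by norm_num : (0 : ℝ) < 2)]; norm_num

/-- `1 ≤ √2`. [folklore] -/
theorem one_le_sqrt_two : 1 ≤ Real.sqrt 2 := by
  rw [Real.le_sqrt (by norm_num) (by norm_num)]; norm_num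

/-- For `d ≥ 7`, `shellWt d t ≤ 2^{d-2} (2^t)^{-5}`. [folklore] -/
theorem shellWt_le (hd : 7 ≤ d) (t : ℕ) : shellWt d t ≤ (2 : ℝ) ^ (d - 2) * (((2 : ℝ) ^ t) ^ 5)⁻¹ := by
  unfold shellWt
  refine mul_le_mul_of_nonneg_left (inv_anti₀ (by positivity) ?_) (by positivity)
  exact pow_le_pow_right₀ (one_le_pow₀ (by norm_num)) (by omega)

/-- **One dyadic term** (`d ≥ 7`): for `2^{t+1} ≥ e^{d+5}`,
`shellWt d t · ψ(2^{t+1}) ≤ (2^{d+2} 14⁷ √2 + 2^{d-2} 3^d) (√2/2)^t`.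
[cite: KozmaNachmias2011, proof of Lemma 5.5 (p. 403)] -/
theorem shellWt_mul_psiKN_le (hd : 7 ≤ d) {t : ℕ} (ht : Real.exp (d + 5) ≤ (2 : ℝ) ^ (t + 1)) :
    shellWt d t * psiKN d ((2 : ℝ) ^ (t + 1)) ≤
      ((2 : ℝ) ^ (d + 2) * 14 ^ 7 * Real.sqrt 2 + 2 ^ (d - 2) * 3 ^ d) * (Real.sqrt 2 / 2) ^ t := by
  have hψ := psiKN_le (d := d) ht
  have hw := shellWt_le hd t
  have hw0 := shellWt_nonneg d t
  set a : ℝ := (2 : ℝ) ^ t with ha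
  have ha0 : 0 < a := by positivity
  have hsqrt : Real.sqrt ((2 : ℝ) ^ (t + 1)) = Real.sqrt 2 * Real.sqrt 2 ^ t := by
    rw [sqrt_two_pow, pow_succ, mul_comm]
  -- first term: `2^{d-2} a^{-5} · 14⁷ (2a)^4 √2 √2^t = 2^{d+2} 14⁷ √2 (√2/2)^t`
  have h1 : (2 : ℝ) ^ (d - 2) * (a ^ 5)⁻¹ * (14 ^ 7 * (((2 : ℝ) ^ (t + 1)) ^ 4 * Real.sqrt ((2 : ℝ) ^ (t + 1)))) =
      (2 : ℝ) ^ (d + 2) * 14 ^ 7 * Real.sqrt 2 * (Real.sqrt 2 / 2) ^ t := by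
    rw [hsqrt, pow_succ, div_pow]
    rw [show (2 : ℝ) ^ (d + 2) = 2 ^ (d - 2) * 2 ^ 4 by rw [← pow_add]; congr 1; omega]
    field_simp
    ring
  -- second term: `2^{d-2} a^{-5} 3^d ≤ 2^{d-2} 3^d (√2/2)^t`
  have hbound : (a ^ 5)⁻¹ ≤ (Real.sqrt 2 / 2) ^ t := by
    calc (a ^ 5)⁻¹ ≤ a⁻¹ := by
          refine inv_anti₀ ha0 ?_
          calc a = a ^ 1 := (pow_one a).symm
            _ ≤ a ^ 5 := pow_le_pow_right₀ (by rw [ha]; exact one_le_pow₀ (by norm_num)) (by norm_num)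
      _ = (2⁻¹) ^ t := by rw [ha, inv_pow]
      _ ≤ (Real.sqrt 2 / 2) ^ t := by
          refine pow_le_pow_left₀ (by norm_num) ?_ t
          rw [inv_eq_one_div, div_le_div_iff_of_pos_right two_pos]
          exact one_le_sqrt_two
  have h2 : (2 : ℝ) ^ (d - 2) * (a ^ 5)⁻¹ * 3 ^ d ≤ 2 ^ (d - 2) * 3 ^ d * (Real.sqrt 2 / 2) ^ t := by
    calc (2 : ℝ) ^ (d - 2) * (a ^ 5)⁻¹ * 3 ^ d = 2 ^ (d - 2) * 3 ^ d * (a ^ 5)⁻¹ := by ring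
      _ ≤ _ := mul_le_mul_of_nonneg_left hbound (by positivity)
  calc shellWt d t * psiKN d ((2 : ℝ) ^ (t + 1))
      ≤ ((2 : ℝ) ^ (d - 2) * (a ^ 5)⁻¹) * (14 ^ 7 * (((2 : ℝ) ^ (t + 1)) ^ 4 * Real.sqrt ((2 : ℝ) ^ (t + 1))) + 3 ^ d) :=
        mul_le_mul hw hψ (psiKN_nonneg (le_trans (by have := Real.add_one_le_exp ((d : ℝ) + 5); linarith [this]) ht))
          (by positivity)
    _ = (2 : ℝ) ^ (d - 2) * (a ^ 5)⁻¹ * (14 ^ 7 * (((2 : ℝ) ^ (t + 1)) ^ 4 * Real.sqrt ((2 : ℝ) ^ (t + 1)))) +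
          (2 : ℝ) ^ (d - 2) * (a ^ 5)⁻¹ * 3 ^ d := by ring
    _ ≤ (2 : ℝ) ^ (d + 2) * 14 ^ 7 * Real.sqrt 2 * (Real.sqrt 2 / 2) ^ t +
          2 ^ (d - 2) * 3 ^ d * (Real.sqrt 2 / 2) ^ t := by rw [h1]; exact add_le_add le_rfl h2
    _ = _ := by ring

end OneTerm

/-! ### The three tail estimates -/

section Tails

/-- There is `t₁` with `2^{t+1} ≥ e^{d+5}` for all `t ≥ t₁`. [folklore] -/
theorem exists_exp_le_two_pow (d : ℕ) : ∃ t₁ : ℕ, ∀ t, t₁ ≤ t → Real.exp (d + 5) ≤ (2 : ℝ) ^ (t + 1) := by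
  refine ⟨⌈Real.exp (d + 5)⌉₊, fun t ht => ?_⟩
  calc Real.exp (d + 5) ≤ ⌈Real.exp (d + 5)⌉₊ := Nat.le_ceil _
    _ ≤ t := by exact_mod_cast ht
    _ ≤ (t + 1 : ℕ) := by exact_mod_cast Nat.le_succ t
    _ ≤ ((2 ^ (t + 1) : ℕ) : ℝ) := by exact_mod_cast (Nat.lt_two_pow_self).le
    _ = (2 : ℝ) ^ (t + 1) := by push_cast; ring

/-- A finite geometric sum over an arbitrary finite set of exponents `≥ t₀`:
`Σ_{t ∈ S} θ^t ≤ θ^{t₀}/(1-θ)`. [folklore] -/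
theorem sum_pow_le_of_forall_le {θ : ℝ} (hθ0 : 0 ≤ θ) (hθ1 : θ < 1) {S : Finset ℕ} {t₀ : ℕ}
    (hS : ∀ t ∈ S, t₀ ≤ t) : ∑ t ∈ S, θ ^ t ≤ θ ^ t₀ / (1 - θ) := by
  classical
  have hsub : S ⊆ Finset.Ico t₀ (S.sup id + 1) := fun t ht =>
    Finset.mem_Ico.2 ⟨hS t ht, Nat.lt_succ_of_le (Finset.le_sup (f := id) ht)⟩
  calc ∑ t ∈ S, θ ^ t ≤ ∑ t ∈ Finset.Ico t₀ (S.sup id + 1), θ ^ t :=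
        Finset.sum_le_sum_of_subset_of_nonneg hsub fun t _ _ => pow_nonneg hθ0 t
    _ ≤ θ ^ t₀ / (1 - θ) := geom_sum_Ico_le_of_lt_one hθ0 hθ1

/-- **Tail over the large scales** (Kozma–Nachmias 2011, p. 401: "`Σ_{t ≥ log(K/2)} t⁷ 2^{t(6-d)} ≤
C K^{6-d} log⁷ K`"; p. 403: "`Σ_{t > t₀} 2^{t(6-d)} t⁷`" and the negligible `2^{td} e^{-t²}`), `d ≥ 7`:
for every `δ > 0` there is `K₀` such that for `K ≥ K₀` and every finite set `S` of scales with
`2^t ≥ K`, `Σ_{t ∈ S} shellWt d t · ψ(2^{t+1}) ≤ δ`.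
[cite: KozmaNachmias2011, proof of Lemma 5.3 (p. 401) and of Lemma 5.5 (p. 403)] -/
theorem tail_large (hd : 7 ≤ d) {δ : ℝ} (hδ : 0 < δ) :
    ∃ K₀ : ℕ, ∀ K : ℕ, K₀ ≤ K → ∀ S : Finset ℕ, (∀ t ∈ S, (K : ℝ) ≤ (2 : ℝ) ^ t) →
      ∑ t ∈ S, shellWt d t * psiKN d ((2 : ℝ) ^ (t + 1)) ≤ δ := by
  set A : ℝ := (2 : ℝ) ^ (d + 2) * 14 ^ 7 * Real.sqrt 2 + 2 ^ (d - 2) * 3 ^ d with hA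
  set θ : ℝ := Real.sqrt 2 / 2 with hθ
  have hA0 : 0 < A := by positivity
  have hθ0 : 0 ≤ θ := by positivity
  have hθ1 : θ < 1 := by rw [hθ, div_lt_one two_pos]; exact sqrt_two_lt_two
  obtain ⟨t₁, ht₁⟩ := exists_exp_le_two_pow d
  have h1θ : 0 < 1 - θ := by linarith
  obtain ⟨t₂, ht₂⟩ : ∃ t₂ : ℕ, θ ^ t₂ < δ * (1 - θ) / A :=
    exists_pow_lt_of_lt_one (by positivity) hθ1
  refine ⟨2 ^ max t₁ t₂, fun K hK S hS => ?_⟩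
  have ht : ∀ t ∈ S, max t₁ t₂ ≤ t := by
    intro t htS
    have h1 : ((2 ^ max t₁ t₂ : ℕ) : ℝ) ≤ (2 : ℝ) ^ t := (Nat.cast_le.2 hK).trans (hS t htS)
    have h2 : (2 : ℝ) ^ max t₁ t₂ ≤ (2 : ℝ) ^ t := by exact_mod_cast h1
    exact (pow_le_pow_iff_right₀ (by norm_num : (1 : ℝ) < 2)).1 h2
  calc ∑ t ∈ S, shellWt d t * psiKN d ((2 : ℝ) ^ (t + 1)) ≤ ∑ t ∈ S, A * θ ^ t :=
        Finset.sum_le_sum fun t htS => shellWt_mul_psiKN_le hd (ht₁ t (le_of_max_le_left (ht t htS)))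
    _ = A * ∑ t ∈ S, θ ^ t := by rw [Finset.mul_sum]
    _ ≤ A * (θ ^ max t₁ t₂ / (1 - θ)) := mul_le_mul_of_nonneg_left (sum_pow_le_of_forall_le hθ0 hθ1 ht) hA0.le
    _ ≤ A * (θ ^ t₂ / (1 - θ)) :=
        mul_le_mul_of_nonneg_left (div_le_div_of_nonneg_right
          (pow_le_pow_of_le_one hθ0 hθ1.le (le_max_right _ _)) h1θ.le) hA0.le
    _ ≤ δ := by
        rw [lt_div_iff₀ hA0] at ht₂
        rw [mul_div_assoc', div_le_iff₀ h1θ]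
        linarith

/-- `1/√K ≤ δ` for `K ≥ ⌈δ⁻²⌉ + 1`. [folklore] -/
theorem inv_sqrt_le {δ : ℝ} (hδ : 0 < δ) {K : ℕ} (hK : ⌈(δ ^ 2)⁻¹⌉₊ + 1 ≤ K) : (Real.sqrt K)⁻¹ ≤ δ := by
  have hK0 : (0 : ℝ) < K := by exact_mod_cast (show 0 < K by omega)
  have h1 : (δ ^ 2)⁻¹ ≤ K := le_trans (Nat.le_ceil _) (by exact_mod_cast (show ⌈(δ ^ 2)⁻¹⌉₊ ≤ K by omega))
  rw [inv_le_comm₀ (Real.sqrt_pos.2 hK0) hδ, Real.le_sqrt (inv_nonneg.2 hδ.le) hK0.le, inv_pow]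
  exact h1

/-- **The middle scales of Lemma 5.3** (`K/4 ≤ 2^t`, bounded by the budget at scale `2K`), `d ≥ 7`:
for every `δ > 0` there is `K₀` such that for `K ≥ K₀` and every finite set `S` of scales with
`4 · 2^t ≥ K`, `(Σ_{t ∈ S} shellWt d t) · (2K)⁴ log⁷(2K) ≤ δ` (a geometric sum
`≤ 2 · 8^{d-2} K^{-(d-2)}` against `14⁷ (2K)⁴ √(2K)`, i.e. `O(K^{6.5-d}) = O(K^{-1/2})`).
[cite: KozmaNachmias2011, proof of Lemma 5.3 (p. 401)] -/
theorem tail_mid (hd : 7 ≤ d) {δ : ℝ} (hδ : 0 < δ) :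
    ∃ K₀ : ℕ, ∀ K : ℕ, K₀ ≤ K → ∀ S : Finset ℕ, (∀ t ∈ S, (K : ℝ) ≤ 4 * (2 : ℝ) ^ t) →
      (∑ t ∈ S, shellWt d t) * (((2 * K : ℕ) : ℝ) ^ 4 * Real.log ((2 * K : ℕ) : ℝ) ^ 7) ≤ δ := by
  classical
  obtain ⟨e, rfl⟩ : ∃ e, d = e + 7 := ⟨d - 7, by omega⟩
  -- constants
  set B : ℝ := 2 ^ (e + 5) * 2 * 4 ^ (e + 5) * (14 ^ 7 * 16 * 2) with hB
  have hB0 : 0 < B := by positivity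
  refine ⟨⌈((δ / B) ^ 2)⁻¹⌉₊ + 1, fun K hK S hS => ?_⟩
  have hK1 : 1 ≤ K := by omega
  have hK0 : (0 : ℝ) < K := by exact_mod_cast (show 0 < K by omega)
  have hK1' : (1 : ℝ) ≤ K := by exact_mod_cast hK1
  have hinv : (Real.sqrt K)⁻¹ ≤ δ / B := inv_sqrt_le (by positivity) hK
  -- the least scale `t*` with `K ≤ 4 · 2^{t*}`
  have hex : ∃ t : ℕ, (K : ℝ) ≤ 4 * (2 : ℝ) ^ t := ⟨K, by
    have : (K : ℝ) < (2 : ℝ) ^ K := by exact_mod_cast Nat.lt_two_pow_self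
    linarith [pow_pos (show (0:ℝ) < 2 by norm_num) K]⟩
  set ts := Nat.find hex with hts
  have hts_spec : (K : ℝ) ≤ 4 * (2 : ℝ) ^ ts := Nat.find_spec hex
  have hts_min : ∀ t ∈ S, ts ≤ t := fun t ht => Nat.find_min' hex (hS t ht)
  -- geometric sum of the shell weights
  set x : ℝ := ((2 : ℝ) ^ (e + 5))⁻¹ with hx
  have hx0 : 0 ≤ x := by positivity
  have hx1 : x < 1 := by rw [hx]; exact inv_lt_one_of_one_lt₀ (one_lt_pow₀ (by norm_num) (by omega))
  have hx12 : x ≤ 1 / 2 := by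
    rw [hx, one_div]; exact inv_anti₀ two_pos (le_self_pow₀ (by norm_num) (by omega))
  have hshell : ∀ t, shellWt (e + 7) t = 2 ^ (e + 5) * x ^ t := by
    intro t
    simp only [shellWt, show e + 7 - 2 = e + 5 by omega, hx, inv_pow, ← pow_mul]
    ring
  have hsum : ∑ t ∈ S, shellWt (e + 7) t ≤ 2 ^ (e + 5) * (2 * x ^ ts) := by
    rw [Finset.sum_congr rfl fun t _ => hshell t, ← Finset.mul_sum]
    refine mul_le_mul_of_nonneg_left ?_ (by positivity)
    calc ∑ t ∈ S, x ^ t ≤ x ^ ts / (1 - x) := sum_pow_le_of_forall_le hx0 hx1 hts_min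
      _ ≤ x ^ ts / (1 / 2) := div_le_div_of_nonneg_left (pow_nonneg hx0 _) (by norm_num) (by linarith)
      _ = 2 * x ^ ts := by ring
  -- `x^{ts} = (2^{ts})^{-(e+5)} ≤ (4/K)^{e+5}`
  have hxts : x ^ ts ≤ (4 / K) ^ (e + 5) := by
    rw [hx, inv_pow, ← pow_mul, mul_comm, pow_mul]
    rw [show (4 / (K : ℝ)) ^ (e + 5) = (((K : ℝ) / 4) ^ (e + 5))⁻¹ by rw [← inv_pow, inv_div]]
    refine inv_anti₀ (by positivity) (pow_le_pow_left₀ (by positivity) ?_ _)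
    linarith
  -- the budget at scale `2K`
  have h2K1 : (1 : ℝ) ≤ ((2 * K : ℕ) : ℝ) := by exact_mod_cast (show 1 ≤ 2 * K by omega)
  have hlog := log_pow_seven_le_sqrt h2K1
  have hsqrt2K : Real.sqrt ((2 * K : ℕ) : ℝ) ≤ 2 * Real.sqrt K := by
    push_cast
    rw [Real.sqrt_mul' 2 hK0.le]
    exact mul_le_mul_of_nonneg_right sqrt_two_lt_two.le (Real.sqrt_nonneg _)
  have hbudget : ((2 * K : ℕ) : ℝ) ^ 4 * Real.log ((2 * K : ℕ) : ℝ) ^ 7 ≤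
      14 ^ 7 * 16 * 2 * ((K : ℝ) ^ 4 * Real.sqrt K) := by
    calc ((2 * K : ℕ) : ℝ) ^ 4 * Real.log ((2 * K : ℕ) : ℝ) ^ 7
        ≤ ((2 * K : ℕ) : ℝ) ^ 4 * (14 ^ 7 * Real.sqrt ((2 * K : ℕ) : ℝ)) :=
          mul_le_mul_of_nonneg_left hlog (by positivity)
      _ ≤ ((2 * K : ℕ) : ℝ) ^ 4 * (14 ^ 7 * (2 * Real.sqrt K)) := by gcongr
      _ = 14 ^ 7 * 16 * 2 * ((K : ℝ) ^ 4 * Real.sqrt K) := by push_cast; ring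
  -- `(4/K)^{e+5} K⁴ √K ≤ 4^{e+5} / √K`
  have hsK : Real.sqrt K * Real.sqrt K = K := Real.mul_self_sqrt hK0.le
  have hsK0 : 0 < Real.sqrt K := Real.sqrt_pos.2 hK0
  have hKpow : ((4 : ℝ) / K) ^ (e + 5) * ((K : ℝ) ^ 4 * Real.sqrt K) ≤ 4 ^ (e + 5) * (Real.sqrt K)⁻¹ := by
    have hid : ((4 : ℝ) / K) ^ (e + 5) * ((K : ℝ) ^ 4 * Real.sqrt K) =
        4 ^ (e + 5) * (Real.sqrt K)⁻¹ * (((K : ℝ) ^ 4 * (Real.sqrt K * Real.sqrt K)) / (K : ℝ) ^ (e + 5)) := by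
      rw [div_pow]
      field_simp
    rw [hid, hsK]
    refine mul_le_of_le_one_right (by positivity) ?_
    rw [div_le_one (by positivity), ← pow_succ]
    exact pow_le_pow_right₀ hK1' (by omega)
  calc (∑ t ∈ S, shellWt (e + 7) t) * (((2 * K : ℕ) : ℝ) ^ 4 * Real.log ((2 * K : ℕ) : ℝ) ^ 7)
      ≤ (2 ^ (e + 5) * (2 * (4 / K) ^ (e + 5))) * (14 ^ 7 * 16 * 2 * ((K : ℝ) ^ 4 * Real.sqrt K)) := by
        refine mul_le_mul (hsum.trans ?_) hbudget (by positivity) (by positivity)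
        gcongr
    _ = (2 ^ (e + 5) * 2 * (14 ^ 7 * 16 * 2)) * (((4 : ℝ) / K) ^ (e + 5) * ((K : ℝ) ^ 4 * Real.sqrt K)) := by
        ring
    _ ≤ (2 ^ (e + 5) * 2 * (14 ^ 7 * 16 * 2)) * (4 ^ (e + 5) * (Real.sqrt K)⁻¹) :=
        mul_le_mul_of_nonneg_left hKpow (by positivity)
    _ = B * (Real.sqrt K)⁻¹ := by rw [hB]; ring
    _ ≤ B * (δ / B) := mul_le_mul_of_nonneg_left hinv hB0.le
    _ = δ := by field_simp

/-- **Tail over the small scales after randomisation** (Kozma–Nachmias 2011, p. 403: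
"`C K^{4-d} log⁷ K Σ_{t ≤ t₀} 2^{2t} ≤ C K^{6-d} log⁷ K`", with the `2^{td} e^{-t₀²}` term negligible),
`d ≥ 7`: for every `δ > 0` there is `K₀` such that for `K ≥ K₀` and every finite set `S` of scales
with `2^t < K`, `(Σ_{t ∈ S} shellWt d t (2·2^t+1)^d) · ψ(2K) / (K/4)^d ≤ δ`.
[cite: KozmaNachmias2011, proof of Lemma 5.5 (p. 403)] -/
theorem tail_small (hd : 7 ≤ d) {δ : ℝ} (hδ : 0 < δ) :
    ∃ K₀ : ℕ, ∀ K : ℕ, K₀ ≤ K → ∀ S : Finset ℕ, (∀ t ∈ S, (2 : ℝ) ^ t < K) →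
      (∑ t ∈ S, shellWt d t * (2 * (2 : ℝ) ^ t + 1) ^ d) * psiKN d ((2 * K : ℕ) : ℝ) /
        ((K : ℝ) / 4) ^ d ≤ δ := by
  classical
  obtain ⟨e, rfl⟩ : ∃ e, d = e + 7 := ⟨d - 7, by omega⟩
  set P : ℝ := 14 ^ 7 * 32 + 3 ^ (e + 7) with hP
  set B : ℝ := 2 ^ (e + 6) * 3 ^ (e + 7) * P * 4 ^ (e + 7) with hB
  have hB0 : 0 < B := by positivity
  refine ⟨max ⌈Real.exp (↑(e + 7) + 5)⌉₊ (⌈((δ / B) ^ 2)⁻¹⌉₊ + 1), fun K hK S hS => ?_⟩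
  have hK2 : ⌈((δ / B) ^ 2)⁻¹⌉₊ + 1 ≤ K := le_of_max_le_right hK
  have hK1 : 1 ≤ K := by omega
  have hKne : K ≠ 0 := by omega
  have hK0 : (0 : ℝ) < K := by exact_mod_cast (show 0 < K by omega)
  have hK1' : (1 : ℝ) ≤ K := by exact_mod_cast hK1
  have hinv : (Real.sqrt K)⁻¹ ≤ δ / B := inv_sqrt_le (by positivity) hK2
  have hexp : Real.exp (↑(e + 7) + 5) ≤ ((2 * K : ℕ) : ℝ) := by
    calc Real.exp (↑(e + 7) + 5) ≤ ⌈Real.exp (↑(e + 7) + 5)⌉₊ := Nat.le_ceil _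
      _ ≤ K := by exact_mod_cast le_of_max_le_left hK
      _ ≤ ((2 * K : ℕ) : ℝ) := by exact_mod_cast (show K ≤ 2 * K by omega)
  -- (a) one term: `shellWt t (2·2^t+1)^d ≤ 2^{d-2} 3^d 4^t`
  have hterm : ∀ t : ℕ, shellWt (e + 7) t * (2 * (2 : ℝ) ^ t + 1) ^ (e + 7) ≤
      2 ^ (e + 5) * 3 ^ (e + 7) * (4 : ℝ) ^ t := by
    intro t
    have h1 : (1 : ℝ) ≤ 2 ^ t := one_le_pow₀ (by norm_num)
    calc shellWt (e + 7) t * (2 * (2 : ℝ) ^ t + 1) ^ (e + 7)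
        ≤ shellWt (e + 7) t * (3 * (2 : ℝ) ^ t) ^ (e + 7) :=
          mul_le_mul_of_nonneg_left (pow_le_pow_left₀ (by positivity) (by linarith) _) (shellWt_nonneg _ _)
      _ = 2 ^ (e + 5) * 3 ^ (e + 7) * (4 : ℝ) ^ t := by
          unfold shellWt
          rw [show e + 7 - 2 = e + 5 by omega, show (4 : ℝ) ^ t = ((2 : ℝ) ^ t) ^ 2 by
            rw [← pow_mul, mul_comm, pow_mul]; norm_num]
          field_simp
          ring
  -- (b) the geometric sum `Σ_{2^t < K} 4^t ≤ 2K²`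
  have hgeom : ∑ t ∈ S, (4 : ℝ) ^ t ≤ 2 * (K : ℝ) ^ 2 := by
    set n := Nat.log 2 K + 1 with hn
    have hsub : S ⊆ Finset.range n := by
      intro t ht
      have h1 : (2 : ℝ) ^ t < K := hS t ht
      have h2 : 2 ^ t ≤ K := by exact_mod_cast h1.le
      exact Finset.mem_range.2 (Nat.lt_succ_of_le (Nat.le_log_of_pow_le one_lt_two h2))
    have hpow : (4 : ℝ) ^ n ≤ 4 * (K : ℝ) ^ 2 := by
      have h := Nat.pow_log_le_self 2 hKne
      have h' : ((2 ^ Nat.log 2 K : ℕ) : ℝ) ≤ K := by exact_mod_cast h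
      push_cast at h'
      rw [hn, pow_succ, show (4 : ℝ) ^ Nat.log 2 K = ((2 : ℝ) ^ Nat.log 2 K) ^ 2 by
        rw [← pow_mul, mul_comm, pow_mul]; norm_num]
      nlinarith [pow_nonneg (show (0 : ℝ) ≤ 2 by norm_num) (Nat.log 2 K)]
    calc ∑ t ∈ S, (4 : ℝ) ^ t ≤ ∑ t ∈ Finset.range n, (4 : ℝ) ^ t :=
          Finset.sum_le_sum_of_subset_of_nonneg hsub fun t _ _ => by positivity
      _ = ((4 : ℝ) ^ n - 1) / (4 - 1) := geom_sum_eq (by norm_num) n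
      _ ≤ 2 * (K : ℝ) ^ 2 := by rw [div_le_iff₀ (by norm_num)]; nlinarith
  have hsumS : ∑ t ∈ S, shellWt (e + 7) t * (2 * (2 : ℝ) ^ t + 1) ^ (e + 7) ≤
      2 ^ (e + 5) * 3 ^ (e + 7) * (2 * (K : ℝ) ^ 2) := by
    calc ∑ t ∈ S, shellWt (e + 7) t * (2 * (2 : ℝ) ^ t + 1) ^ (e + 7)
        ≤ ∑ t ∈ S, 2 ^ (e + 5) * 3 ^ (e + 7) * (4 : ℝ) ^ t := Finset.sum_le_sum fun t _ => hterm t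
      _ = 2 ^ (e + 5) * 3 ^ (e + 7) * ∑ t ∈ S, (4 : ℝ) ^ t := by rw [Finset.mul_sum]
      _ ≤ _ := mul_le_mul_of_nonneg_left hgeom (by positivity)
  -- (c) the budget at scale `2K`
  have hsK : Real.sqrt K * Real.sqrt K = K := Real.mul_self_sqrt hK0.le
  have hsK0 : 0 < Real.sqrt K := Real.sqrt_pos.2 hK0
  have hsqrt2K : Real.sqrt ((2 * K : ℕ) : ℝ) ≤ 2 * Real.sqrt K := by
    push_cast
    rw [Real.sqrt_mul' 2 hK0.le]
    exact mul_le_mul_of_nonneg_right sqrt_two_lt_two.le (Real.sqrt_nonneg _)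
  have hψ : psiKN (e + 7) ((2 * K : ℕ) : ℝ) ≤ P * ((K : ℝ) ^ 4 * Real.sqrt K) := by
    have h := psiKN_le (d := e + 7) hexp
    have hKs1 : 1 ≤ (K : ℝ) ^ 4 * Real.sqrt K :=
      one_le_mul_of_one_le_of_one_le (one_le_pow₀ hK1') ((Real.le_sqrt zero_le_one hK0.le).2 (by simpa using hK1'))
    calc psiKN (e + 7) ((2 * K : ℕ) : ℝ)
        ≤ 14 ^ 7 * (((2 * K : ℕ) : ℝ) ^ 4 * Real.sqrt ((2 * K : ℕ) : ℝ)) + 3 ^ (e + 7) := h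
      _ ≤ 14 ^ 7 * (((2 * K : ℕ) : ℝ) ^ 4 * (2 * Real.sqrt K)) + 3 ^ (e + 7) * ((K : ℝ) ^ 4 * Real.sqrt K) := by
          gcongr
          · exact le_mul_of_one_le_right (by positivity) hKs1
      _ = P * ((K : ℝ) ^ 4 * Real.sqrt K) := by rw [hP]; push_cast; ring
  -- (d) combine
  have hden : 0 < ((K : ℝ) / 4) ^ (e + 7) := by positivity
  have hmain : (2 ^ (e + 5) * 3 ^ (e + 7) * (2 * (K : ℝ) ^ 2)) * (P * ((K : ℝ) ^ 4 * Real.sqrt K)) /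
      ((K : ℝ) / 4) ^ (e + 7) ≤ B * (Real.sqrt K)⁻¹ := by
    have hid : (2 ^ (e + 5) * 3 ^ (e + 7) * (2 * (K : ℝ) ^ 2)) * (P * ((K : ℝ) ^ 4 * Real.sqrt K)) /
        ((K : ℝ) / 4) ^ (e + 7) =
        B * (Real.sqrt K)⁻¹ * ((K : ℝ) ^ 6 * (Real.sqrt K * Real.sqrt K) / (K : ℝ) ^ (e + 7)) := by
      rw [hB, div_pow]
      field_simp
      ring
    rw [hid, hsK]
    refine mul_le_of_le_one_right (by positivity) ?_
    rw [div_le_one (by positivity), ← pow_succ]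
    exact pow_le_pow_right₀ hK1' (by omega)
  calc (∑ t ∈ S, shellWt (e + 7) t * (2 * (2 : ℝ) ^ t + 1) ^ (e + 7)) * psiKN (e + 7) ((2 * K : ℕ) : ℝ) /
        ((K : ℝ) / 4) ^ (e + 7)
      ≤ (2 ^ (e + 5) * 3 ^ (e + 7) * (2 * (K : ℝ) ^ 2)) * (P * ((K : ℝ) ^ 4 * Real.sqrt K)) /
          ((K : ℝ) / 4) ^ (e + 7) := by
        refine div_le_div_of_nonneg_right (mul_le_mul hsumS hψ ?_ (by positivity)) hden.le
        exact psiKN_nonneg (by exact_mod_cast (show 1 ≤ 2 * K by omega))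
    _ ≤ B * (Real.sqrt K)⁻¹ := hmain
    _ ≤ B * (δ / B) := mul_le_mul_of_nonneg_left hinv hB0.le
    _ = δ := by field_simp

end Tails

end Literature.Barriers.CriticalPhenomena

end
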